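import Mathlib
import Literature.NumberTheory.Transcendental.ZagierDilogarithmConjecture
import Literature.NumberTheory.Transcendental.BlochWignerDilogarithmProofs
import Literature.NumberTheory.Transcendental.BlochWignerDistribution
import Summits.KontsevichZagierPeriods.KontsevichZagierPeriods.Theorems.HyperbolicBlochZagierDilogarithmConjectureStubDistributionSlice
import Summits.KontsevichZagierPeriods.KontsevichZagierPeriods.Theorems.HyperbolicBlochZagierDilogarithmConjectureDehnRigidity
import HarnessLib

/-!
# `ZagierDilogarithmConjecture` (stmt-KontsevichZagierPeriods-10550) — line
`kummer-clausen-linearisation` (reshape c4, "the cyclotomic sector, exactly"), stub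
`stub_sexticSector`

**Zagier's conjecture holds UNCONDITIONALLY on the sixth roots of unity.** Let
`D = blochWignerDilog` be the Bloch–Wigner dilogarithm and `C = ⟨dilogRelators⟩ ⊆ ℤ[ℂ]` the relator
group (five-term relators at algebraic points, conjugation pairs `[w] + [w̄]` for algebraic `w`, real
points `[w]`). If `u₁, …, u_k` are sixth roots of unity in the upper half plane and
`n₁, …, n_k ∈ ℤ` satisfy `Σ nᵢ D(uᵢ) = 0`, then `Σ nᵢ [uᵢ] ∈ C`.

Proof (what / why), with `ζ = ζ₆ = e^{2πi/6} = 1/2 + (√3/2) i`.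
* `μ₆ ∩ ℍ⁺ = {ζ, ζ²}` (`eq_zeta_or_eq_zeta_sq`): every sixth root of unity is `ζʲ`, `j < 6`
  (`IsPrimitiveRoot.eq_pow_of_pow_eq_one`), and `ζ³ = −1`, `ζ² = ζ − 1` show that only
  `j = 1, 2` have positive imaginary part.
* VALUES: `3 D(ζ²) = 2 D(ζ)` (`three_mul_blochWignerDilog_zeta_sq`) — the distribution relation
  `D(x²) = 2 (D(x) + D(−x))` (`blochWignerDilog_pow_distribution`, `N = 2`) at `x = ζ` together
  with `−ζ = conj (ζ²)` and `D(w̄) = −D(w)` (`blochWignerDilog_conj'`); and `D(ζ) > 0`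
  (`blochWignerDilog_pos`, positivity of `D` on `ℍ⁺`).
* SYMBOLS: `2[ζ] − 3[ζ²] ∈ C` (`two_zsmul_of_zeta_sub_mem`) — minus the sum of the formal
  distribution slice `[x²] − 2([x] + [−x]) ∈ C` (`stub_distributionSlice`, `N = 2`, `x = ζ`
  algebraic; tree) and twice the conjugation relator `[ζ²] + [conj ζ²] = [ζ²] + [−ζ]`.
* ASSEMBLY: with `a = Σ_{uᵢ = ζ} nᵢ`, `b = Σ_{uᵢ = ζ²} nᵢ` (`sum_split`) the relation reads
  `a D(ζ) + b D(ζ²) = 0`, so `(3a + 2b) D(ζ) = 0`, `3a + 2b = 0`, `(a, b) = (2t, −3t)` and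
  `Σ nᵢ[uᵢ] = a[ζ] + b[ζ²] = t · (2[ζ] − 3[ζ²]) ∈ C`.
Mathlib + the tree's distribution-slice / positivity files only; sorry-free;
axioms ⊆ {propext, Classical.choice, Quot.sound}.

## References

* W. D. Neumann, *Hilbert's 3rd problem and invariants of 3-manifolds*, Geom. Topol. Monogr. 1
  (1998), §2.1 (the relator group, `D(z̄) = −D(z)`, Zagier's conjecture). [Neumann1998]
* J. L. Dupont, *Scissors congruences, group homology and characteristic classes*, World
  Scientific (2001), Cor. 8.15 (distribution relations). [Dupont2001]
* J. Milnor, *Hyperbolic geometry: the first 150 years*, Bull. AMS 6 (1982), Appendix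
  (positivity of the volume function). [Milnor1982]
-/

noncomputable section

open scoped BigOperators ComplexConjugate
open Literature.NumberTheory.Transcendental

namespace Summit.KontsevichZagierPeriods.HyperbolicBloch.ZagierDilogarithmCyclotomic

open Summit.KontsevichZagierPeriods.HyperbolicBloch.ZagierDilogarithm (blochWignerDilog_pos)
open Summit.KontsevichZagierPeriods.HyperbolicBloch.ZagierDilogarithmGaloisDescent
  (stub_distributionSlice)

namespace SexticSector

/-! ### Two generalities -/

/-- `e^{2πi/2} = −1`. [folklore] -/
theorem exp_two_pi_I_div_two : Complex.exp (2 * Real.pi * Complex.I / 2) = -1 := by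
  rw [show (2 * Real.pi * Complex.I / 2 : ℂ) = Real.pi * Complex.I by ring]
  exact Complex.exp_pi_mul_I

/-- If every `uᵢ` is `ζ` or `ζ²`, then `Σ nᵢ [uᵢ] = a[ζ] + b[ζ²]` and
`Σ nᵢ D(uᵢ) = a D(ζ) + b D(ζ²)` with `a = Σ_{uᵢ = ζ} nᵢ`, `b = Σ_{uᵢ ≠ ζ} nᵢ`. [folklore] -/
theorem sum_split {k : ℕ} {u : Fin k → ℂ} {ζ : ℂ} (h : ∀ i, u i = ζ ∨ u i = ζ ^ 2)
    (n : Fin k → ℤ) :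
    ∃ a b : ℤ,
      (∑ i, n i • FreeAbelianGroup.of (u i)) =
          a • FreeAbelianGroup.of ζ + b • FreeAbelianGroup.of (ζ ^ 2) ∧
        ∑ i, (n i : ℝ) * blochWignerDilog (u i) =
          a * blochWignerDilog ζ + b * blochWignerDilog (ζ ^ 2) := by
  classical
  have key : ∀ {M : Type} [AddCommGroup M] (φ : ℂ → M), ∑ i, n i • φ (u i) =
      (∑ i ∈ Finset.univ.filter (fun i => u i = ζ), n i) • φ ζ +
        (∑ i ∈ Finset.univ.filter (fun i => ¬u i = ζ), n i) • φ (ζ ^ 2) := by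
    intro M _ φ
    rw [Finset.sum_smul, Finset.sum_smul,
      ← Finset.sum_filter_add_sum_filter_not Finset.univ (fun i => u i = ζ)]
    congr 1
    · exact Finset.sum_congr rfl fun i hi => by rw [(Finset.mem_filter.1 hi).2]
    · exact Finset.sum_congr rfl fun i hi => by
        rw [(h i).resolve_left (Finset.mem_filter.1 hi).2]
  refine ⟨_, _, key FreeAbelianGroup.of, ?_⟩
  have hv := key blochWignerDilog
  simpa only [zsmul_eq_mul] using hv

/-! ### The sixth root of unity `ζ = ζ₆ = e^{2πi/6}` -/

section zeta

variable {ζ : ℂ} (hζ : ζ = Complex.exp (2 * Real.pi * Complex.I / 6))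
include hζ

/-- `ζ₆` is a primitive sixth root of unity. [folklore] -/
theorem zeta_isPrimitiveRoot : IsPrimitiveRoot ζ 6 := by
  subst hζ
  have h := Complex.isPrimitiveRoot_exp 6 (by norm_num)
  simp only [Nat.cast_ofNat] at h
  exact h

/-- `ζ₆` is algebraic (a root of `X⁶ − 1`). [folklore] -/
theorem zeta_isAlgebraic : IsAlgebraic ℚ ζ := by
  refine ⟨Polynomial.X ^ 6 - 1, Polynomial.X_pow_sub_C_ne_zero (by norm_num) 1, ?_⟩
  simp [(zeta_isPrimitiveRoot hζ).pow_eq_one]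

/-- Closed form: `ζ₆ = cos(π/3) + i sin(π/3) = 1/2 + (√3/2) i`. [folklore] -/
theorem zeta_eq : ζ = ⟨1 / 2, Real.sqrt 3 / 2⟩ := by
  subst hζ
  have h : (2 * Real.pi * Complex.I / 6 : ℂ) = ((Real.pi / 3 : ℝ) : ℂ) * Complex.I := by
    push_cast
    ring
  rw [h, Complex.exp_mul_I, ← Complex.ofReal_cos, ← Complex.ofReal_sin, Real.cos_pi_div_three,
    Real.sin_pi_div_three]
  apply Complex.ext <;> simp

/-- `Re ζ₆ = 1/2`. [folklore] -/
theorem zeta_re : ζ.re = 1 / 2 := by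
  rw [zeta_eq hζ]

/-- `Im ζ₆ = √3/2 > 0`: `ζ₆` lies in the upper half plane. [folklore] -/
theorem zeta_im_pos : 0 < ζ.im := by
  rw [zeta_eq hζ]
  positivity

/-- `ζ₆³ = e^{πi} = −1`. [folklore] -/
theorem zeta_pow_three : ζ ^ 3 = -1 := by
  subst hζ
  rw [← Complex.exp_nat_mul]
  have h : ((3 : ℕ) : ℂ) * (2 * Real.pi * Complex.I / 6) = Real.pi * Complex.I := by
    push_cast
    ring
  rw [h]
  exact Complex.exp_pi_mul_I

/-- `ζ₆² = ζ₆ − 1` (from `(ζ₆ + 1)(ζ₆² − ζ₆ + 1) = ζ₆³ + 1 = 0` and `ζ₆ ≠ −1`). [folklore] -/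
theorem zeta_sq : ζ ^ 2 = ζ - 1 := by
  have hne : ζ + 1 ≠ 0 := by
    intro h
    have him := congrArg Complex.im h
    simp only [Complex.add_im, Complex.one_im, add_zero, Complex.zero_im] at him
    exact (zeta_im_pos hζ).ne' him
  have hprod : (ζ + 1) * (ζ ^ 2 - (ζ - 1)) = 0 := by
    have e : (ζ + 1) * (ζ ^ 2 - (ζ - 1)) = ζ ^ 3 + 1 := by ring
    rw [e, zeta_pow_three hζ, neg_add_cancel]
  exact sub_eq_zero.1 ((mul_eq_zero.1 hprod).resolve_left hne)

/-- `conj (ζ₆²) = −ζ₆` (both equal `−1/2 − (√3/2) i`). [folklore] -/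
theorem conj_zeta_sq : conj (ζ ^ 2) = -ζ := by
  rw [zeta_sq hζ, map_sub, map_one]
  apply Complex.ext
  · simp only [Complex.sub_re, Complex.conj_re, Complex.one_re, Complex.neg_re, zeta_re hζ]
    norm_num
  · simp

/-! ### Classification of the sixth roots of unity in the upper half plane -/

/-- **`μ₆ ∩ ℍ⁺ = {ζ₆, ζ₆²}`**: a sixth root of unity with positive imaginary part is `ζ₆` or `ζ₆²`
(the other four, `1, −1, −ζ₆, 1 − ζ₆`, have imaginary part `≤ 0`). [folklore] -/
theorem eq_zeta_or_eq_zeta_sq {u : ℂ} (hu : u ^ 6 = 1) (him : 0 < u.im) :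
    u = ζ ∨ u = ζ ^ 2 := by
  obtain ⟨i, hi, rfl⟩ := (zeta_isPrimitiveRoot hζ).eq_pow_of_pow_eq_one hu
  have h3 := zeta_pow_three hζ
  have h2 := zeta_sq hζ
  have hs := zeta_im_pos hζ
  interval_cases i
  · simp at him
  · exact Or.inl (pow_one _)
  · exact Or.inr rfl
  · rw [h3] at him
    simp at him
  · have e : ζ ^ 4 = -ζ := by
      rw [show ζ ^ 4 = ζ ^ 3 * ζ by ring, h3, neg_one_mul]
    rw [e, Complex.neg_im] at him
    linarith
  · have e : ζ ^ 5 = 1 - ζ := by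
      rw [show ζ ^ 5 = ζ ^ 3 * ζ ^ 2 by ring, h3, h2]
      ring
    rw [e, Complex.sub_im, Complex.one_im] at him
    linarith

/-! ### The value relation `3 D(ζ₆²) = 2 D(ζ₆)` -/

/-- **`3 D(ζ₃) = 2 D(ζ₆)`** (`ζ₃ = ζ₆²`): the distribution relation `D(ζ₆²) = 2(D(ζ₆) + D(−ζ₆))`
and `D(−ζ₆) = D(conj ζ₆²) = −D(ζ₆²)`. [cite: Dupont2001, Cor. 8.15] -/
theorem three_mul_blochWignerDilog_zeta_sq :
    3 * blochWignerDilog (ζ ^ 2) = 2 * blochWignerDilog ζ := by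
  have h1 := blochWignerDilog_pow_distribution (N := 2) two_pos ζ
  simp only [Nat.cast_ofNat] at h1
  simp only [Finset.sum_range_succ, Finset.sum_range_zero, zero_add, pow_zero, one_mul, pow_one,
    exp_two_pi_I_div_two, neg_one_mul] at h1
  have h2 : blochWignerDilog (-ζ) = -blochWignerDilog (ζ ^ 2) := by
    rw [← conj_zeta_sq hζ, blochWignerDilog_conj']
  rw [h2] at h1
  linarith

/-! ### The symbol relation `2[ζ₆] − 3[ζ₆²] ∈ ⟨dilogRelators⟩` -/

/-- **`2[ζ₆] − 3[ζ₆²] ∈ ⟨dilogRelators⟩`**: minus the sum of the distribution slice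
`[ζ₆²] − 2([ζ₆] + [−ζ₆])` (`stub_distributionSlice`, `N = 2`, `x = ζ₆`) and twice the conjugation
relator `[ζ₆²] + [conj ζ₆²] = [ζ₆²] + [−ζ₆]`. [cite: Dupont2001, Cor. 8.15] -/
theorem two_zsmul_of_zeta_sub_mem :
    (2 : ℤ) • FreeAbelianGroup.of ζ - (3 : ℤ) • FreeAbelianGroup.of (ζ ^ 2) ∈
      AddSubgroup.closure dilogRelators := by
  have h1 := stub_distributionSlice 2 two_pos ζ (zeta_isAlgebraic hζ)
  simp only [Nat.cast_ofNat] at h1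
  simp only [Finset.sum_range_succ, Finset.sum_range_zero, zero_add, pow_zero, one_mul, pow_one,
    exp_two_pi_I_div_two, neg_one_mul] at h1
  -- `h1 : [ζ²] − 2 • ([ζ] + [−ζ]) ∈ C`
  have h2 : FreeAbelianGroup.of (ζ ^ 2) + FreeAbelianGroup.of (-ζ) ∈
      AddSubgroup.closure dilogRelators := by
    have h := of_add_of_conj_mem_dilogRelators ((zeta_isAlgebraic hζ).pow 2)
    rw [conj_zeta_sq hζ] at h
    exact AddSubgroup.subset_closure h
  have h3 := neg_mem (add_mem h1 (AddSubgroup.nsmul_mem _ h2 2))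
  convert h3 using 1
  abel

end zeta

end SexticSector

open SexticSector in
/-- **Zagier's conjecture for sixth roots of unity (UNCONDITIONAL)** (stub `stub_sexticSector` of
line `kummer-clausen-linearisation`): a `ℤ`-relation `Σ nᵢ D(uᵢ) = 0` among Bloch–Wigner values at
points `uᵢ ∈ μ₆ ∩ ℍ⁺ = {ζ₆, ζ₃}` is explained, `Σ nᵢ [uᵢ] ∈ ⟨dilogRelators⟩`: `3D(ζ₃) = 2D(ζ₆)` and
`D(ζ₆) > 0` force the relation to be `t · (2[ζ₆] − 3[ζ₃])`, and `2[ζ₆] − 3[ζ₃]` is a distribution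
slice plus conjugation relators. [cite: Neumann1998, §2.1] -/
theorem stub_sexticSector :
    ∀ (k : ℕ) (u : Fin k → ℂ) (n : Fin k → ℤ), (∀ i, u i ^ 6 = 1) → (∀ i, 0 < (u i).im) →
      ∑ i, (n i : ℝ) * blochWignerDilog (u i) = 0 →
        (∑ i, n i • FreeAbelianGroup.of (u i)) ∈ AddSubgroup.closure dilogRelators := by
  intro k u n hu him hrel
  obtain ⟨ζ, hζ⟩ : ∃ ζ : ℂ, ζ = Complex.exp (2 * Real.pi * Complex.I / 6) := ⟨_, rfl⟩
  have hclass : ∀ i, u i = ζ ∨ u i = ζ ^ 2 := fun i => eq_zeta_or_eq_zeta_sq hζ (hu i) (him i)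
  obtain ⟨a, b, hf, hv⟩ := sum_split hclass n
  rw [hv] at hrel
  -- the value relation forces `3a + 2b = 0`
  have hD := three_mul_blochWignerDilog_zeta_sq hζ
  have hpos := blochWignerDilog_pos (zeta_im_pos hζ)
  have hab' : ((3 * a + 2 * b : ℤ) : ℝ) * blochWignerDilog ζ = 0 := by
    push_cast
    linear_combination 3 * hrel - (b : ℝ) * hD
  have hab : 3 * a + 2 * b = 0 := by
    exact_mod_cast (mul_eq_zero.1 hab').resolve_right hpos.ne'
  -- so `(a, b) = (2t, −3t)` and the symbol is `t • (2[ζ] − 3[ζ²])`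
  obtain ⟨t, rfl⟩ : ∃ t, a = 2 * t := ⟨-(a + b), by omega⟩
  obtain rfl : b = -3 * t := by omega
  rw [hf]
  have e : (2 * t) • FreeAbelianGroup.of ζ + (-3 * t) • FreeAbelianGroup.of (ζ ^ 2) =
      t • ((2 : ℤ) • FreeAbelianGroup.of ζ - (3 : ℤ) • FreeAbelianGroup.of (ζ ^ 2)) := by
    rw [smul_sub, smul_smul, smul_smul, mul_comm t 2, mul_comm t 3, neg_mul, neg_smul,
      sub_eq_add_neg]
  rw [e]
  exact AddSubgroup.zsmul_mem _ (two_zsmul_of_zeta_sub_mem hζ) t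

end Summit.KontsevichZagierPeriods.HyperbolicBloch.ZagierDilogarithmCyclotomic

end
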